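import Mathlib
import Summits.MatrixMultiplication.MatrixMultiplication.Theses.FourierTwoFamiliesModP
import Summits.MatrixMultiplication.MatrixMultiplication.Theorems.PrimeTwoFamilies.Negative.Slices
import Literature.Computability.AlgebraicComplexity.SimultaneousDoubleProduct
import Summits.MatrixMultiplication.MatrixMultiplication.Theorems.FourierTwoFamiliesModPCyclicReductionTransfer
import Summits.MatrixMultiplication.MatrixMultiplication.Theorems.FourierTwoFamiliesModPPrimeTwoFamiliesCapacityLift
import Summits.MatrixMultiplication.MatrixMultiplication.Theorems.FourierTwoFamiliesModPPrimeTwoFamiliesStubSelfConverse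
import Summits.MatrixMultiplication.MatrixMultiplication.Theorems.FourierTwoFamiliesModPPrimeTwoFamiliesStubCapBookkeeping
import Summits.MatrixMultiplication.MatrixMultiplication.Theorems.FourierTwoFamiliesModPPrimeTwoFamiliesStubGadgetsOfCrux
import Summits.MatrixMultiplication.MatrixMultiplication.Theorems.FourierTwoFamiliesModPPrimeTwoFamiliesStubPackingTightOfCrux
import Summits.MatrixMultiplication.MatrixMultiplication.Theorems.FourierTwoFamiliesModPPrimeTwoFamiliesStubCruxOfPackingTight

/-!
# `PrimeTwoFamilies ↔` capacity gadgets `↔` self-converse gadgets `↔` packing-tight at every scale;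
# the single-scale kill criterion (line `Sketch`, cycle c1, crux stmt-MatrixMultiplication-14308)

The deliverable of line `Sketch` in its capacity-gadget form (idea `zero-error-capacity-gadgets`) together
with the kill-side calibration of the crux-plan `ladder-zone-frame-cap` (PaddingSketch), in closed form.
CKSU 2005 Conj. 4.7 with prime cyclic hosts (`FourierTwoFamiliesModP.PrimeTwoFamilies`) is EQUIVALENT to each
of:

* CAPACITY GADGETS (`capacityGadgets_iff_primeTwoFamilies`): for every `ε > 0` and arbitrarily large `m`, a
  list of direct pairs `(P c, Q c)_{c<r}` in `ℤ/m` of co-volume `≥ m^{1-ε}` and a set `W` of words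
  `Fin L → Fin r` (`L ≥ 1`) of size `≥ (m^L)^{1/2-ε}` in which every ordered pair of distinct words is
  strongly separated in some coordinate (a zero-error code).  (⇒ crux: `primeTwoFamiliesAt_of_capacityGadgets`
  — code lift `codeLift`, carry-free transfer `exists_prime_sdpp_of_addEquiv`, bookkeeping
  `stub_capBookkeeping`; ⇐: `stub_gadgetsOfCrux` + `stub_selfConverse`.)
* SELF-CONVERSE GADGETS (`selfConverseGadgets_iff_primeTwoFamilies`, the L = 2 form): `r ≥ m^{1-ε}` direct
  pairs of co-volume `≥ m^{1-ε}` and a map `π` separating every ordered pair of distinct letters directly or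
  after `π`.  NOT strictly stronger than the crux: letter repetition (`stub_gadgetsOfCrux`).
* PACKING-TIGHT AT EVERY SCALE (`primeTwoFamilies_iff_packingTightAt`): for every `γ ∈ (0,1)` and `ε > 0`,
  arbitrarily large primes `p` carry SDPP families with all co-volumes `≥ p^γ` and `n ≥ p^{1-γ/2-ε}` pairs
  (`stub_packingTightOfCrux`: padding by the singleton design + transfer; `stub_cruxOfPackingTight`).

Consequently the SINGLE-SCALE KILL CRITERION `primeTwoFamilies_false_of_singleScaleDefect`: a power defect
`n ≤ p^{1-γ/2-c}` (`c > 0`) for all SDPP families of co-volume `≥ p^γ` in all large prime cyclic groups, at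
ANY ONE scale `γ ∈ (0,1)`, refutes the crux (generalises `PowerGainRefutes`, whose hypothesis is a defect at
all scales at once).
-/

-- single-conjunct summit: the mandated namespace repeats `MatrixMultiplication` (summit = sub-problem).
set_option linter.dupNamespace false

namespace Summit.MatrixMultiplication.MatrixMultiplication.Theorems.PrimeTwoFamilies.CapacityLift

open Finset
open Summit.MatrixMultiplication.MatrixMultiplication.Theses
open Summit.MatrixMultiplication.MatrixMultiplication.Theorems
open Summit.MatrixMultiplication.MatrixMultiplication.Theorems.PrimeTwoFamilies.Negative
open Literature.Computability.AlgebraicComplexity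

/-- **Capacity gadgets give the crux, slice by slice.**  If for every `ε > 0` there are arbitrarily large
`m`, direct pairs `(P c, Q c)_{c<r}` in `ZMod m` of co-volume `m^{1-ε} ≤ |P c||Q c|` and a zero-error code
`W` of words `Fin L → Fin r` (`1 ≤ L`, every ordered pair of distinct words strongly separated in some
coordinate) with `(m^L)^{1/2-ε} ≤ |W|`, then every slice `0 < δ ≤ 1` of `PrimeTwoFamilies` holds.
Composition: choose `ε` by `stub_capBookkeeping`; take a gadget level `m ≥ max m₀ 1`; lift (`codeLift`) and
enumerate `W` by `Fin N`; move into `ℤ/p` by `exists_prime_sdpp_of_addEquiv` (`k = L` factors `ℤ/m`); keep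
the first `n` pairs. -/
theorem primeTwoFamiliesAt_of_capacityGadgets
    (hC : ∀ ε : ℝ, 0 < ε → ∀ m₀ : ℕ, ∃ m ≥ m₀, ∃ r L : ℕ, ∃ P Q : Fin r → Finset (ZMod m),
      ∃ W : Finset (Fin L → Fin r),
      (∀ c : Fin r, ∀ x ∈ P c, ∀ x' ∈ P c, ∀ y ∈ Q c, ∀ y' ∈ Q c,
          (x - x') + (y - y') = 0 → x = x' ∧ y = y') ∧
      (∀ i ∈ W, ∀ k ∈ W, i ≠ k → ∃ t : Fin L,
        ∀ p ∈ P (i t), ∀ q ∈ Q (k t), ∀ c : Fin r, ∀ p' ∈ P c, ∀ q' ∈ Q c, q - p ≠ q' - p') ∧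
      1 ≤ L ∧
      ((m : ℝ) ^ (L : ℝ)) ^ (1 / 2 - ε) ≤ (W.card : ℝ) ∧
      ∀ c : Fin r, (m : ℝ) ^ (1 - ε) ≤ (((P c).card * (Q c).card : ℕ) : ℝ))
    {δ : ℝ} (hδ : 0 < δ) (hδ1 : δ ≤ 1) : PrimeTwoFamiliesAt δ := by
  classical
  intro n₀
  obtain ⟨ε, hε, hbook⟩ := stub_capBookkeeping δ hδ hδ1
  obtain ⟨m₀, hm₀⟩ := hbook n₀
  obtain ⟨m, hm, r, L, P, Q, W, hD, hCode, hL, hWcard, hcov⟩ := hC ε hε (max m₀ 1)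
  have hm₀m : m₀ ≤ m := le_trans (le_max_left _ _) hm
  have hm1 : 1 ≤ m := le_trans (le_max_right _ _) hm
  set N : ℕ := W.card with hN
  let e : W ≃ Fin N := W.equivFin
  -- the lifted family, indexed by `Fin N`
  let A : Fin N → Finset (Fin L → ZMod m) :=
    fun i => Fintype.piFinset (fun t => P ((e.symm i : Fin L → Fin r) t))
  let B : Fin N → Finset (Fin L → ZMod m) :=
    fun i => Fintype.piFinset (fun t => Q ((e.symm i : Fin L → Fin r) t))
  obtain ⟨hW1, hX1⟩ := codeLift P Q hD W hCode
  have hWA : ∀ i : Fin N, ∀ a ∈ A i, ∀ a' ∈ A i, ∀ b ∈ B i, ∀ b' ∈ B i,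
      (a - a') + (b - b') = 0 → a = a' ∧ b = b' :=
    fun i => hW1 _ (e.symm i).2
  have hXA : ∀ i j k : Fin N, ∀ a ∈ A i, ∀ a' ∈ A j, ∀ b ∈ B j, ∀ b' ∈ B k,
      (a - a') + (b - b') = 0 → i = k := by
    intro i j k a ha a' ha' b hb b' hb' h0
    have hik := hX1 _ (e.symm i).2 _ (e.symm j).2 _ (e.symm k).2 a ha a' ha' b hb b' hb' h0
    exact e.symm.injective (Subtype.ext hik)
  -- transfer into a prime cyclic host (tree: route support CyclicReduction, transfer step)
  obtain ⟨p, hp, hpR, A', B', hcard, hW', hX'⟩ :=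
    exists_prime_sdpp_of_addEquiv hWA hXA (m := fun _ : Fin L => m) (fun _ => hm1)
      (AddEquiv.refl (Fin L → ZMod m))
  rw [Fin.prod_const] at hpR
  -- the number of pairs kept
  obtain ⟨n, hn₀, hnN, hpn, hnP⟩ := hm₀ m hm₀m L hL N hWcard p hpR
  refine ⟨n, hn₀, p, hp, A' ∘ Fin.castLE hnN, B' ∘ Fin.castLE hnN, ?_, ?_, hpn, ?_⟩
  · intro i
    exact hW' (Fin.castLE hnN i)
  · intro i j k a ha a' ha' b hb b' hb' h0
    exact Fin.castLE_injective hnN (hX' _ _ _ a ha a' ha' b hb b' hb' h0)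
  · intro i
    have hci := hcard (Fin.castLE hnN i)
    simp only [Function.comp_apply]
    rw [hci.1, hci.2]
    simp only [A, B, Fintype.card_piFinset]
    rw [← Finset.prod_mul_distrib]
    refine hnP.trans ?_
    rw [← Fin.prod_const]
    push_cast
    refine Finset.prod_le_prod (fun t _ => by positivity) fun t _ => ?_
    exact_mod_cast hcov _

/-- **Capacity gadgets ↔ `PrimeTwoFamilies`.**  (⇒) `primeTwoFamiliesAt_of_capacityGadgets` for `δ ≤ 1`
and slice monotonicity above; (⇐) the crux gives self-converse gadgets by letter repetition
(`stub_gadgetsOfCrux`), whose graph words are a code (`stub_selfConverse`). -/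
theorem capacityGadgets_iff_primeTwoFamilies :
    (∀ ε : ℝ, 0 < ε → ∀ m₀ : ℕ, ∃ m ≥ m₀, ∃ r L : ℕ, ∃ P Q : Fin r → Finset (ZMod m),
      ∃ W : Finset (Fin L → Fin r),
      (∀ c : Fin r, ∀ x ∈ P c, ∀ x' ∈ P c, ∀ y ∈ Q c, ∀ y' ∈ Q c,
          (x - x') + (y - y') = 0 → x = x' ∧ y = y') ∧
      (∀ i ∈ W, ∀ k ∈ W, i ≠ k → ∃ t : Fin L,
        ∀ p ∈ P (i t), ∀ q ∈ Q (k t), ∀ c : Fin r, ∀ p' ∈ P c, ∀ q' ∈ Q c, q - p ≠ q' - p') ∧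
      1 ≤ L ∧
      ((m : ℝ) ^ (L : ℝ)) ^ (1 / 2 - ε) ≤ (W.card : ℝ) ∧
      ∀ c : Fin r, (m : ℝ) ^ (1 - ε) ≤ (((P c).card * (Q c).card : ℕ) : ℝ)) ↔
    FourierTwoFamiliesModP.PrimeTwoFamilies := by
  refine ⟨fun hC => ?_, fun hT => stub_selfConverse (stub_gadgetsOfCrux hT)⟩
  rw [primeTwoFamilies_iff]
  intro δ hδ
  by_cases h1 : δ ≤ 1
  · exact primeTwoFamiliesAt_of_capacityGadgets hC hδ h1
  · exact (primeTwoFamiliesAt_of_capacityGadgets hC one_pos le_rfl).mono (le_of_not_ge h1)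

/-- **Self-converse gadgets ↔ `PrimeTwoFamilies`** (the L = 2 form of the capacity line is equivalent to,
not stronger than, the crux): (⇒) through `stub_selfConverse` and `capacityGadgets_iff_primeTwoFamilies`;
(⇐) letter repetition, `stub_gadgetsOfCrux`. -/
theorem selfConverseGadgets_iff_primeTwoFamilies :
    (∀ ε : ℝ, 0 < ε → ∀ m₀ : ℕ, ∃ m ≥ m₀, ∃ r : ℕ, ∃ P Q : Fin r → Finset (ZMod m),
      ∃ π : Fin r → Fin r,
      (∀ c : Fin r, ∀ x ∈ P c, ∀ x' ∈ P c, ∀ y ∈ Q c, ∀ y' ∈ Q c,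
          (x - x') + (y - y') = 0 → x = x' ∧ y = y') ∧
      (∀ σ τ : Fin r, σ ≠ τ →
        (∀ p ∈ P σ, ∀ q ∈ Q τ, ∀ c : Fin r, ∀ p' ∈ P c, ∀ q' ∈ Q c, q - p ≠ q' - p') ∨
        (∀ p ∈ P (π σ), ∀ q ∈ Q (π τ), ∀ c : Fin r, ∀ p' ∈ P c, ∀ q' ∈ Q c, q - p ≠ q' - p')) ∧
      (m : ℝ) ^ (1 - ε) ≤ (r : ℝ) ∧
      ∀ c : Fin r, (m : ℝ) ^ (1 - ε) ≤ (((P c).card * (Q c).card : ℕ) : ℝ)) ↔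
    FourierTwoFamiliesModP.PrimeTwoFamilies :=
  ⟨fun h => capacityGadgets_iff_primeTwoFamilies.1 (stub_selfConverse h), fun hT => stub_gadgetsOfCrux hT⟩

/-- **`PrimeTwoFamilies ↔` packing-tight at every scale `γ ∈ (0,1)`** (crux-plan ladder-zone-frame-cap §A):
CKSU Conj. 4.7 (prime cyclic) holds iff SDPP families pack perfectly in exponent at EVERY block scale — for
every `γ ∈ (0,1)`, `ε > 0`, arbitrarily large primes `p` carry SDPP families with all co-volumes `≥ p^γ`
and `n ≥ p^{1-γ/2-ε}` pairs.  (⇒) `stub_packingTightOfCrux` (padding + transfer); (⇐)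
`stub_cruxOfPackingTight` (`γ = 1 - δ/8`). -/
theorem primeTwoFamilies_iff_packingTightAt :
    FourierTwoFamiliesModP.PrimeTwoFamilies ↔
    ∀ γ : ℝ, 0 < γ → γ < 1 →
      ∀ ε : ℝ, 0 < ε → ∀ p₀ : ℕ, ∃ p ≥ p₀, p.Prime ∧ ∃ (n : ℕ) (A B : Fin n → Finset (ZMod p)),
        (∀ i : Fin n, ∀ a ∈ A i, ∀ a' ∈ A i, ∀ b ∈ B i, ∀ b' ∈ B i,
            (a - a') + (b - b') = 0 → a = a' ∧ b = b') ∧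
        (∀ i j k : Fin n, ∀ a ∈ A i, ∀ a' ∈ A j, ∀ b ∈ B j, ∀ b' ∈ B k,
            (a - a') + (b - b') = 0 → i = k) ∧
        (∀ i : Fin n, (p : ℝ) ^ γ ≤ (((A i).card * (B i).card : ℕ) : ℝ)) ∧
        (p : ℝ) ^ (1 - γ / 2 - ε) ≤ (n : ℝ) :=
  ⟨fun hT _ hγ hγ1 => stub_packingTightOfCrux hT hγ hγ1,
   fun h => primeTwoFamilies_iff.2 (stub_cruxOfPackingTight h)⟩

/-- **SINGLE-SCALE KILL CRITERION.**  If at ONE scale `γ ∈ (0,1)` there is a power defect `c > 0` — for all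
primes `p ≥ p₀`, every SDPP family in `ZMod p` with all co-volumes `≥ p^γ` has `n ≤ p^{1-γ/2-c}` pairs —
then `PrimeTwoFamilies` is false (by `stub_packingTightOfCrux` at `ε = c/2`).  Generalises the route's kill
link `PowerGainRefutes` (a defect at all scales simultaneously) to the single most convenient scale. -/
theorem primeTwoFamilies_false_of_singleScaleDefect {γ c : ℝ} (hγ : 0 < γ) (hγ1 : γ < 1) (hc : 0 < c)
    (h : ∃ p₀ : ℕ, ∀ p : ℕ, p.Prime → p₀ ≤ p → ∀ (n : ℕ) (A B : Fin n → Finset (ZMod p)),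
      (∀ i : Fin n, ∀ a ∈ A i, ∀ a' ∈ A i, ∀ b ∈ B i, ∀ b' ∈ B i,
          (a - a') + (b - b') = 0 → a = a' ∧ b = b') →
      (∀ i j k : Fin n, ∀ a ∈ A i, ∀ a' ∈ A j, ∀ b ∈ B j, ∀ b' ∈ B k,
          (a - a') + (b - b') = 0 → i = k) →
      (∀ i : Fin n, (p : ℝ) ^ γ ≤ (((A i).card * (B i).card : ℕ) : ℝ)) →
      (n : ℝ) ≤ (p : ℝ) ^ (1 - γ / 2 - c)) :
    ¬ FourierTwoFamiliesModP.PrimeTwoFamilies := by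
  intro hT
  obtain ⟨p₀, hp₀⟩ := h
  obtain ⟨p, hp, hprime, n, A, B, hW, hX, hcov, hn⟩ :=
    stub_packingTightOfCrux hT hγ hγ1 (c / 2) (by linarith) (max p₀ 2)
  have hle := hp₀ p hprime ((le_max_left _ _).trans hp) n A B hW hX hcov
  have hp2 : (2 : ℝ) ≤ p := by exact_mod_cast (le_max_right _ _).trans hp
  have hlt : (p : ℝ) ^ (1 - γ / 2 - c) < (p : ℝ) ^ (1 - γ / 2 - c / 2) :=
    Real.rpow_lt_rpow_of_exponent_lt (by linarith) (by linarith)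
  linarith [hn.trans hle]

end Summit.MatrixMultiplication.MatrixMultiplication.Theorems.PrimeTwoFamilies.CapacityLift
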